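import Mathlib
import Literature.Combinatorics.Additive.TricoloredSumFreeBound
import Literature.Barriers.MatrixMultiplication.TricoloredSumFreeBarrierEffective
import Literature.Barriers.MatrixMultiplication.TricoloredSumFreeBarrierProofs
import Literature.Computability.AlgebraicComplexity.GroupTheoreticMatMulProofs

set_option linter.dupNamespace false
-- (single-conjunct summit: the mandated namespace repeats `MatrixMultiplication`)

/-!
# The rank-form slice-rank packing bound (U2 universality stub `stub_rankPackingBound`)

Support file of crux `EisensteinValCertificates.HomocyclicSTPPDesigns` (stmt-MatrixMultiplication-10647),
first hypothesis of the universality glue `HomocyclicSTPPDesigns_of_subs` (`…UniversalityGlue.lean`):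
every STPP family in `K ≃ (Π_{l<n} ℤ/p^{r_l}) × G'` (ONE prime `p`, exponents `r_l ≥ 1`, `G'` any
finite abelian group) has `Σ_i (|A_i||B_i||C_i|)^{2/3} ≤ ((3/4)·2^{1/3})^n · |K|` (`= e^{-δn}|K|`,
`exp_neg_bccgnsuDelta`) — BCCGNSU 2017, Prop. 4.13/4.15 + Thm. 4.14 + §3.2 run with PER-COORDINATE
moduli `q_l = p^{r_l}` (the tree's `hasSliceRankLE_piZMod`, `IsTricoloredSumFree.card_le_of_addEquiv`,
`LargeBlock.sum_rpow_two_thirds_le_of_addEquiv_piZMod` treat one common modulus `q`): slice rank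
`≤ 3 · #LowWeightW` for the vectors `v ∈ Π_k {0..q_k-1}` of WEIGHTED weight `Σ_k v_k/(q_k-1) ≤ |κ|/3`,
`#LowWeightW ≤ ((3/4)2^{1/3})^{|κ|} ∏ q_k` (generating function at base `1/2`, chord bound
`2^{-t} ≤ 1 - t/2`), Thm. 4.14 in counting form, coordinates for `((K^N)^3)^{N'}`, the §3.2 engine.

Source: J. Blasiak, T. Church, H. Cohn, J. A. Grochow, E. Naslund, W. F. Sawin, C. Umans, *On cap
sets and the group-theoretic approach to matrix multiplication*, Discrete Analysis 2017:3
(arXiv:1605.06702), Prop. 4.12–4.15, Thm. 4.14, Thm. A′, §3.2.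
-/

namespace Summit.MatrixMultiplication.MatrixMultiplication.Theorems.HomocyclicSTPPDesigns.Universality

open Finset Literature.Computability.AlgebraicComplexity Literature.Combinatorics.Additive
  Literature.Barriers.MatrixMultiplication
open scoped BigOperators

/-! ## §1 Slice rank of `D_{Π_k ℤ/q_k}` over `𝔽_p` with weighted low-weight classes -/

section SliceRank

variable {p : ℕ} [hp : Fact p.Prime]

/-- **BCCGNSU 2017, Prop. 4.13 with Prop. 4.15, dependent moduli.** For prime powers
`q_k = p^{r_k} ≥ 2`, the tensor `∏_k [x_k + y_k + z_k + 1 = 0]` on `(Π_k ℤ/q_k)³` over `𝔽_p` has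
slice rank `≤ 3 · #{v ∈ Π_k {0,…,q_k-1} : 3 Σ_k v_k/(q_k-1) ≤ |κ|}`: expand each factor by
`shiftedIndicator_eq_sum` (`a_k + b_k + c_k = q_k - 1`, so the weighted weights of `a, b, c` add
up to `|κ|` and one is `≤ |κ|/3`) and collect terms with `hasSliceRankLE_of_cover`.
[cite: BlasiakChurchCohnGrochowNaslundSawinUmans2017, Prop. 4.13] -/
theorem hasSliceRankLE_piZMod_dep {κ : Type} [Fintype κ] [DecidableEq κ] (q : κ → ℕ)
    [∀ k, NeZero (q k)] (r : κ → ℕ) (hq : ∀ k, q k = p ^ r k) (hq2 : ∀ k, 2 ≤ q k) :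
    HasSliceRankLE
      (fun x y z : (k : κ) → ZMod (q k) =>
        ∏ k, (if x k + y k + z k + 1 = 0 then (1 : ZMod p) else 0))
      (3 * Fintype.card {v : (k : κ) → Fin (q k) //
        3 * ∑ k, ((v k : ℕ) : ℝ) / ((q k : ℝ) - 1) ≤ Fintype.card κ}) := by
  classical
  -- per-coordinate index sets of the triangle decomposition (Prop. 4.15)
  set S : κ → Finset (Σ _ : ℕ × ℕ, ℕ × ℕ) := fun k =>
    (antidiagonal (q k - 1)).sigma fun ic => antidiagonal ic.1 with hS
  have hmem : ∀ k, ∀ w ∈ S k, w.2.1 + w.2.2 + w.1.2 = q k - 1 := by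
    rintro k ⟨⟨i, c⟩, ⟨a, b⟩⟩ hw
    simp only [hS, mem_sigma, Finset.HasAntidiagonal.mem_antidiagonal] at hw ⊢
    omega
  set n := Fintype.card κ with hn
  have h1 : ∀ (k : κ) (x y z : ZMod (q k)), (if x + y + z + 1 = 0 then (1 : ZMod p) else 0) =
      ∑ w : S k, ((x.val.choose w.1.2.1 : ℕ) : ZMod p) * ((y.val.choose w.1.2.2 : ℕ) : ZMod p) *
        ((z.val.choose w.1.1.2 : ℕ) : ZMod p) := by
    intro k x y z
    rw [shiftedIndicator_eq_sum (r k) (hq k), Finset.sum_sigma']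
    exact (Finset.sum_coe_sort (S k) fun w => ((x.val.choose w.2.1 : ℕ) : ZMod p) *
      ((y.val.choose w.2.2 : ℕ) : ZMod p) * ((z.val.choose w.1.2 : ℕ) : ZMod p)).symm
  -- the rank-one decomposition of the product tensor, indexed by `(k : κ) → S k`
  set Fx : ((k : κ) → S k) → ((k : κ) → ZMod (q k)) → ZMod p :=
    fun ω x => ∏ k, (((x k).val.choose (ω k).1.2.1 : ℕ) : ZMod p) with hFx
  set Fy : ((k : κ) → S k) → ((k : κ) → ZMod (q k)) → ZMod p :=
    fun ω y => ∏ k, (((y k).val.choose (ω k).1.2.2 : ℕ) : ZMod p) with hFy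
  set Fz : ((k : κ) → S k) → ((k : κ) → ZMod (q k)) → ZMod p :=
    fun ω z => ∏ k, (((z k).val.choose (ω k).1.1.2 : ℕ) : ZMod p) with hFz
  have hD : ∀ x y z : (k : κ) → ZMod (q k),
      (∏ k, if x k + y k + z k + 1 = 0 then (1 : ZMod p) else 0) =
      ∑ ω : (k : κ) → S k, Fx ω x * Fy ω y * Fz ω z := by
    intro x y z
    simp_rw [h1]
    rw [Fintype.prod_sum]
    refine Finset.sum_congr rfl fun ω _ => ?_
    rw [hFx, hFy, hFz]
    simp only
    rw [← Finset.prod_mul_distrib, ← Finset.prod_mul_distrib]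
  -- coordinates of the rank-one terms as vectors in `Π_k {0,…,q_k-1}`, and their weights
  have hlt : ∀ (ω : (k : κ) → S k) (k : κ),
      (ω k).1.2.1 < q k ∧ (ω k).1.2.2 < q k ∧ (ω k).1.1.2 < q k := fun ω k => by
    have h := hmem k _ (ω k).2; have hq1 := hq2 k; omega
  set A : ((k : κ) → S k) → (k : κ) → Fin (q k) := fun ω k => ⟨(ω k).1.2.1, (hlt ω k).1⟩
    with hA
  set B : ((k : κ) → S k) → (k : κ) → Fin (q k) := fun ω k => ⟨(ω k).1.2.2, (hlt ω k).2.1⟩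
    with hB
  set C : ((k : κ) → S k) → (k : κ) → Fin (q k) := fun ω k => ⟨(ω k).1.1.2, (hlt ω k).2.2⟩
    with hC
  set W : ((k : κ) → Fin (q k)) → ℝ := fun v => ∑ k, ((v k : ℕ) : ℝ) / ((q k : ℝ) - 1) with hW
  have hABC : ∀ ω, W (A ω) + W (B ω) + W (C ω) = n := by
    intro ω
    have hk : ∀ k, ((A ω k : ℕ) : ℝ) / ((q k : ℝ) - 1) + ((B ω k : ℕ) : ℝ) / ((q k : ℝ) - 1) +
        ((C ω k : ℕ) : ℝ) / ((q k : ℝ) - 1) = 1 := fun k => by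
      have hq2k : (2 : ℝ) ≤ q k := by exact_mod_cast hq2 k
      have h : (ω k).1.2.1 + (ω k).1.2.2 + (ω k).1.1.2 + 1 = q k := by
        have := hmem k _ (ω k).2; have := hq2 k; omega
      rw [← add_div, ← add_div, div_eq_one_iff_eq (by linarith), eq_sub_iff_add_eq]
      simp only [hA, hB, hC]
      exact_mod_cast h
    simp only [hW]
    rw [← Finset.sum_add_distrib, ← Finset.sum_add_distrib, Finset.sum_congr rfl fun k _ => hk k,
      Finset.sum_const, card_univ, nsmul_eq_mul, mul_one]
  -- classes and the three projections to low-weight vectors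
  set c : ((k : κ) → S k) → Fin 3 := fun ω =>
    if 3 * W (A ω) ≤ n then 0 else if 3 * W (B ω) ≤ n then 1 else 2 with hc
  have hcls : ∀ ω, (c ω = 0 → 3 * W (A ω) ≤ n) ∧ (c ω = 1 → 3 * W (B ω) ≤ n) ∧
      (c ω = 2 → 3 * W (C ω) ≤ n) := by
    intro ω
    have h := hABC ω
    simp only [hc]
    split_ifs with h0 h1 <;> refine ⟨fun h' => ?_, fun h' => ?_, fun h' => ?_⟩ <;>
      first | assumption | exact absurd h' (by decide) | (push Not at h0 h1; linarith)
  set πx : ((k : κ) → S k) →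
      {v : (k : κ) → Fin (q k) // 3 * ∑ k, ((v k : ℕ) : ℝ) / ((q k : ℝ) - 1) ≤ n} := fun ω =>
    if h : 3 * W (A ω) ≤ n then ⟨A ω, by simpa [hW] using h⟩ else ⟨fun _ => 0, by simp⟩ with hπx
  set πy : ((k : κ) → S k) →
      {v : (k : κ) → Fin (q k) // 3 * ∑ k, ((v k : ℕ) : ℝ) / ((q k : ℝ) - 1) ≤ n} := fun ω =>
    if h : 3 * W (B ω) ≤ n then ⟨B ω, by simpa [hW] using h⟩ else ⟨fun _ => 0, by simp⟩ with hπy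
  set πz : ((k : κ) → S k) →
      {v : (k : κ) → Fin (q k) // 3 * ∑ k, ((v k : ℕ) : ℝ) / ((q k : ℝ) - 1) ≤ n} := fun ω =>
    if h : 3 * W (C ω) ≤ n then ⟨C ω, by simpa [hW] using h⟩ else ⟨fun _ => 0, by simp⟩ with hπz
  set φ : {v : (k : κ) → Fin (q k) // 3 * ∑ k, ((v k : ℕ) : ℝ) / ((q k : ℝ) - 1) ≤ n} →
      ((k : κ) → ZMod (q k)) → ZMod p :=
    fun v x => ∏ k, (((x k).val.choose (v.1 k : ℕ) : ℕ) : ZMod p) with hφ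
  rw [show ∀ m : ℕ, 3 * m = m + m + m from fun m => by ring]
  refine hasSliceRankLE_of_cover _ Fx Fy Fz hD c πx φ (fun ω h0 => ?_) πy φ (fun ω h1' => ?_)
    πz φ (fun ω h2 => ?_)
  · simp only [hπx, dif_pos ((hcls ω).1 h0)]
    rfl
  · simp only [hπy, dif_pos ((hcls ω).2.1 h1')]
    rfl
  · simp only [hπz, dif_pos ((hcls ω).2.2 h2)]
    rfl

/-- **The weighted low-weight count** (BCCGNSU 2017, Prop. 4.12 in the crude explicit form
`J(q) ≤ J(2) = (3/4)2^{1/3}`): `#{v ∈ Π_k {0,…,q_k-1} : 3 Σ_k v_k/(q_k-1) ≤ |κ|} ≤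
((3/4)·2^{1/3})^{|κ|} · ∏_k q_k` for `q_k ≥ 2` — Markov at base `1/2` and the chord bound
`2^{-t} ≤ 1 - t/2` on `[0,1]` (Bernoulli), whence `Σ_{i<q} 2^{-i/(q-1)} ≤ (3/4) q`.
[cite: BlasiakChurchCohnGrochowNaslundSawinUmans2017, Prop. 4.12] -/
theorem card_lowWeightW_le {κ : Type} [Fintype κ] [DecidableEq κ] (q : κ → ℕ)
    (hq2 : ∀ k, 2 ≤ q k) :
    (Fintype.card {v : (k : κ) → Fin (q k) //
        3 * ∑ k, ((v k : ℕ) : ℝ) / ((q k : ℝ) - 1) ≤ Fintype.card κ} : ℝ) ≤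
      ((3 : ℝ) / 4 * (2 : ℝ) ^ ((1 : ℝ) / 3)) ^ Fintype.card κ * ∏ k, (q k : ℝ) := by
  classical
  set n := Fintype.card κ with hn
  set W : ((k : κ) → Fin (q k)) → ℝ := fun v => ∑ k, ((v k : ℕ) : ℝ) / ((q k : ℝ) - 1) with hW
  -- the chord bound `2^{-t} ≤ 1 - t/2` on `[0,1]` (Bernoulli: `2^{1-t} ≤ 1 + (1-t)`)
  have chord : ∀ t : ℝ, 0 ≤ t → t ≤ 1 → (2 : ℝ) ^ (-t) ≤ 1 - t / 2 := by
    intro t ht0 ht1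
    have hB := rpow_one_add_le_one_add_mul_self (s := (1 : ℝ)) (by norm_num) (p := 1 - t)
      (by linarith) (by linarith)
    have h2 : (2 : ℝ) ^ (-t) = (2 : ℝ) ^ (1 - t) / 2 := by
      rw [sub_eq_add_neg, Real.rpow_add (by norm_num : (0 : ℝ) < 2), Real.rpow_one]
      ring
    rw [h2]
    norm_num at hB
    linarith
  -- the per-coordinate sums
  have hfac : ∀ k, ∑ i : Fin (q k), (2 : ℝ) ^ (-(((i : ℕ) : ℝ) / ((q k : ℝ) - 1))) ≤
      3 / 4 * (q k : ℝ) := by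
    intro k
    have hq2k : (2 : ℝ) ≤ q k := by exact_mod_cast hq2 k
    have hpos : (0 : ℝ) < (q k : ℝ) - 1 := by linarith
    have hsumI : (∑ i : Fin (q k), ((i : ℕ) : ℝ)) = (q k : ℝ) * ((q k : ℝ) - 1) / 2 := by
      have h := congrArg (Nat.cast (R := ℝ)) (Finset.sum_range_id_mul_two (q k))
      push_cast [Nat.cast_sub (le_trans (by norm_num) (hq2 k) : 1 ≤ q k)] at h
      rw [Fin.sum_univ_eq_sum_range (fun i => ((i : ℕ) : ℝ)) (q k)]
      linarith
    calc ∑ i : Fin (q k), (2 : ℝ) ^ (-(((i : ℕ) : ℝ) / ((q k : ℝ) - 1)))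
        ≤ ∑ i : Fin (q k), (1 - (((i : ℕ) : ℝ) / ((q k : ℝ) - 1)) / 2) := by
          refine Finset.sum_le_sum fun i _ => chord _ (by positivity) ?_
          have hi : ((i : ℕ) : ℝ) + 1 ≤ q k := by exact_mod_cast Nat.lt_iff_add_one_le.1 i.2
          rw [div_le_one hpos]
          linarith
      _ = (q k : ℝ) - (∑ i : Fin (q k), ((i : ℕ) : ℝ)) / ((q k : ℝ) - 1) / 2 := by
          rw [Finset.sum_sub_distrib, Finset.sum_const, card_univ, Fintype.card_fin,
            nsmul_eq_mul, mul_one, ← Finset.sum_div, ← Finset.sum_div]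
      _ = 3 / 4 * (q k : ℝ) := by
          rw [hsumI]
          field_simp
          ring
  -- Markov at base `1/2`
  have hmain : (Fintype.card {v : (k : κ) → Fin (q k) //
      3 * ∑ k, ((v k : ℕ) : ℝ) / ((q k : ℝ) - 1) ≤ n} : ℝ) * (2 : ℝ) ^ (-((n : ℝ) / 3)) ≤
      (3 / 4 : ℝ) ^ n * ∏ k, (q k : ℝ) := by
    rw [Fintype.card_subtype]
    calc (#{v : (k : κ) → Fin (q k) | 3 * ∑ k, ((v k : ℕ) : ℝ) / ((q k : ℝ) - 1) ≤ n} : ℝ) *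
          (2 : ℝ) ^ (-((n : ℝ) / 3))
        = ∑ v ∈ univ.filter (fun v => 3 * W v ≤ n), (2 : ℝ) ^ (-((n : ℝ) / 3)) := by
          rw [Finset.sum_const, nsmul_eq_mul]
      _ ≤ ∑ v ∈ univ.filter (fun v => 3 * W v ≤ n), (2 : ℝ) ^ (-(W v)) := by
          refine Finset.sum_le_sum fun v hv => Real.rpow_le_rpow_of_exponent_le (by norm_num) ?_
          linarith [(Finset.mem_filter.1 hv).2]
      _ ≤ ∑ v : (k : κ) → Fin (q k), (2 : ℝ) ^ (-(W v)) :=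
          Finset.sum_le_sum_of_subset_of_nonneg (Finset.filter_subset _ _)
            fun v _ _ => Real.rpow_nonneg (by norm_num) _
      _ = ∑ v : (k : κ) → Fin (q k), ∏ k, (2 : ℝ) ^ (-(((v k : ℕ) : ℝ) / ((q k : ℝ) - 1))) := by
          refine Finset.sum_congr rfl fun v _ => ?_
          rw [hW]
          simp only
          rw [← Finset.sum_neg_distrib]
          exact Real.rpow_sum_of_pos (by norm_num) _ _
      _ = ∏ k, ∑ i : Fin (q k), (2 : ℝ) ^ (-(((i : ℕ) : ℝ) / ((q k : ℝ) - 1))) :=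
          (Fintype.prod_sum fun (k : κ) (i : Fin (q k)) =>
            (2 : ℝ) ^ (-(((i : ℕ) : ℝ) / ((q k : ℝ) - 1)))).symm
      _ ≤ ∏ k, (3 / 4 * (q k : ℝ)) :=
          Finset.prod_le_prod (fun k _ => Finset.sum_nonneg fun i _ =>
            Real.rpow_nonneg (by norm_num) _) fun k _ => hfac k
      _ = (3 / 4 : ℝ) ^ n * ∏ k, (q k : ℝ) := by
          rw [Finset.prod_mul_distrib, Finset.prod_const, card_univ]
  rw [← le_div_iff₀ (Real.rpow_pos_of_pos (by norm_num : (0 : ℝ) < 2) _)] at hmain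
  refine hmain.trans (le_of_eq ?_)
  have hpow : (2 : ℝ) ^ ((n : ℝ) / 3) = ((2 : ℝ) ^ ((1 : ℝ) / 3)) ^ n := by
    rw [← Real.rpow_natCast ((2 : ℝ) ^ ((1 : ℝ) / 3)) n, ← Real.rpow_mul (by norm_num)]
    congr 1
    ring
  rw [Real.rpow_neg (by norm_num), div_inv_eq_mul, hpow, mul_pow]
  ring

/-- **BCCGNSU 2017, Thm. 4.14 in counting form, dependent moduli**: if
`H ≃ (Π_k ℤ/q_k) × G'` with all `q_k = p^{r_k} ≥ 2` powers of ONE prime `p`, every tricolored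
sum-free set in `H` has size `≤ 3 · ((3/4)2^{1/3})^{|κ|} · |H|` (Prop. 4.8 + Prop. 4.2 +
`hasSliceRankLE_piZMod_dep` + `card_lowWeightW_le`; the third family is shifted by `-1`).
[cite: BlasiakChurchCohnGrochowNaslundSawinUmans2017, Thm. 4.14] -/
theorem card_le_of_addEquiv_dep {κ : Type} [Fintype κ] [DecidableEq κ] (q : κ → ℕ)
    [∀ k, NeZero (q k)] (r : κ → ℕ) (hq : ∀ k, q k = p ^ r k) (hq2 : ∀ k, 2 ≤ q k)
    {G' : Type} [AddCommGroup G'] [Fintype G'] [DecidableEq G'] {H : Type} [AddCommGroup H]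
    [Fintype H] (e : H ≃+ ((k : κ) → ZMod (q k)) × G') {ι : Type} [Fintype ι] {s t u : ι → H}
    (h : IsTricoloredSumFree s t u) :
    (Fintype.card ι : ℝ) ≤ 3 * ((3 : ℝ) / 4 * (2 : ℝ) ^ ((1 : ℝ) / 3)) ^ Fintype.card κ *
      Fintype.card H := by
  classical
  have hD := (hasSliceRankLE_piZMod_dep (p := p) q r hq hq2).mul_tensor
    (fun x y z : G' => if x + y + z = 0 then (1 : ZMod p) else 0)
  have hb : Fintype.card ι ≤ 3 * Fintype.card {v : (k : κ) → Fin (q k) //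
      3 * ∑ k, ((v k : ℕ) : ℝ) / ((q k : ℝ) - 1) ≤ Fintype.card κ} * Fintype.card G' := by
    refine hD.card_le_of_matching (fun i => e (s i)) (fun j => e (t j))
      (fun k => e (u k) + (fun _ => -1, 0)) fun i j k => ?_
    have key : s i + t j + u k = 0 ↔
        (∀ l, (e (s i)).1 l + (e (t j)).1 l + ((e (u k)).1 l + -1) + 1 = 0) ∧
          ((e (s i)).2 + (e (t j)).2 + ((e (u k)).2 + 0) = 0) := by
      rw [← e.map_eq_zero_iff, map_add, map_add, Prod.ext_iff, funext_iff]
      simp only [Prod.fst_add, Prod.snd_add, Pi.add_apply, Prod.fst_zero, Prod.snd_zero,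
        Pi.zero_apply, add_zero]
      refine and_congr (forall_congr' fun l => ?_) Iff.rfl
      constructor <;> intro h' <;> rw [← h'] <;> abel
    rw [← h i j k, key]
    simp only [Prod.fst_add, Prod.snd_add, Pi.add_apply, Finset.prod_boole, Finset.mem_univ,
      true_implies, mul_ne_zero_iff, Ne, ite_eq_right_iff, one_ne_zero, imp_false, not_not]
  have hM := card_lowWeightW_le q hq2
  have hcardH : (Fintype.card H : ℝ) = (∏ k, (q k : ℝ)) * Fintype.card G' := by
    have h1 := Fintype.card_congr e.toEquiv
    rw [Fintype.card_prod, Fintype.card_pi] at h1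
    simp only [ZMod.card] at h1
    rw [h1, Nat.cast_mul, Nat.cast_prod]
  calc (Fintype.card ι : ℝ)
      ≤ 3 * (Fintype.card {v : (k : κ) → Fin (q k) //
          3 * ∑ k, ((v k : ℕ) : ℝ) / ((q k : ℝ) - 1) ≤ Fintype.card κ} : ℝ) * Fintype.card G' := by
        exact_mod_cast hb
    _ ≤ 3 * (((3 : ℝ) / 4 * (2 : ℝ) ^ ((1 : ℝ) / 3)) ^ Fintype.card κ * ∏ k, (q k : ℝ)) *
          Fintype.card G' := by gcongr
    _ = 3 * ((3 : ℝ) / 4 * (2 : ℝ) ^ ((1 : ℝ) / 3)) ^ Fintype.card κ * Fintype.card H := by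
        rw [hcardH]
        ring

/-- Thm. 4.14 in counting form for a doubly indexed power of the `p`-part:
`H ≃ (T₁ → T₂ → Π_{l<n} ℤ/p^{r_l}) × G'` (all `r_l ≥ 1`) gives `|M| ≤ 3 ((3/4)2^{1/3})^{|T₁||T₂| n} |H|`
for every tricolored sum-free set (reindex the `p`-part by `Σ Σ Fin n`, `Equiv.piCurry` twice).
[cite: BlasiakChurchCohnGrochowNaslundSawinUmans2017, Thm. 4.14] -/
theorem card_le_of_addEquiv_arrow₂ {n : ℕ} (r : Fin n → ℕ) (hr : ∀ l, 1 ≤ r l) (T₁ T₂ : Type)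
    [Fintype T₁] [DecidableEq T₁] [Fintype T₂] [DecidableEq T₂] {G' : Type} [AddCommGroup G']
    [Fintype G'] [DecidableEq G'] {H : Type} [AddCommGroup H] [Fintype H]
    (e : H ≃+ (T₁ → T₂ → ((l : Fin n) → ZMod (p ^ r l))) × G') {ι : Type} [Fintype ι]
    {s t u : ι → H} (h : IsTricoloredSumFree s t u) :
    (Fintype.card ι : ℝ) ≤ 3 * ((3 : ℝ) / 4 * (2 : ℝ) ^ ((1 : ℝ) / 3)) ^
      (Fintype.card T₁ * (Fintype.card T₂ * n)) * Fintype.card H := by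
  classical
  have hq2 : ∀ k : (Σ _ : T₁, Σ _ : T₂, Fin n), 2 ≤ p ^ r k.2.2 := fun k =>
    le_trans hp.out.two_le (Nat.le_self_pow (by have := hr k.2.2; omega) p)
  let ec₁ : ((k : Σ _ : T₂, Fin n) → ZMod (p ^ r k.2)) ≃+ (T₂ → (l : Fin n) → ZMod (p ^ r l)) :=
    AddEquiv.mk' (Equiv.piCurry fun (_ : T₂) (l : Fin n) => ZMod (p ^ r l)) fun _ _ => rfl
  let ec₂ : ((k : Σ _ : T₁, Σ _ : T₂, Fin n) → ZMod (p ^ r k.2.2)) ≃+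
      (T₁ → (k : Σ _ : T₂, Fin n) → ZMod (p ^ r k.2)) :=
    AddEquiv.mk' (Equiv.piCurry fun (_ : T₁) (k : Σ _ : T₂, Fin n) => ZMod (p ^ r k.2))
      fun _ _ => rfl
  have e' : H ≃+ ((k : Σ _ : T₁, Σ _ : T₂, Fin n) → ZMod (p ^ r k.2.2)) × G' :=
    e.trans (AddEquiv.prodCongr
      (((AddEquiv.piCongrRight fun _ : T₁ => ec₁.symm).trans ec₂.symm)) (AddEquiv.refl G'))
  have hb := card_le_of_addEquiv_dep (p := p) (fun k : (Σ _ : T₁, Σ _ : T₂, Fin n) => p ^ r k.2.2)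
    (fun k => r k.2.2) (fun k => rfl) hq2 e' h
  simpa only [Fintype.card_sigma, Finset.sum_const, card_univ, smul_eq_mul, Fintype.card_fin]
    using hb

end SliceRank

/-! ## §2 Coordinates for the powers `((K^N)^3)^{N'}` -/

/-- From `K ≃ P × G'` to `((K^N)^3)^{N'} ≃ (N' → (N ⊔ N ⊔ N) → P) × ((G'^N)^3)^{N'}` (maps into a
product, `prodProdProdComm` regrouping, `sumArrowEquivProdArrow`; cf. the tree's
`nonempty_addEquiv_pi_of_addEquiv`, `nonempty_addEquiv_triple`). [folklore] -/
theorem nonempty_addEquiv_pow {K P G' : Type} [AddCommGroup K] [AddCommGroup P]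
    [AddCommGroup G'] (e : K ≃+ P × G') (N N' : ℕ) :
    Nonempty ((Fin N' → (Fin N → K) × (Fin N → K) × (Fin N → K)) ≃+
      (Fin N' → (Fin N ⊕ (Fin N ⊕ Fin N)) → P) ×
        (Fin N' → (Fin N → G') × ((Fin N → G') × (Fin N → G')))) := by
  let Q := Fin N → P
  let G₁ := Fin N → G'
  let e₁ : (Fin N → K) ≃+ Q × G₁ := (AddEquiv.piCongrRight fun _ : Fin N => e).trans
    (AddEquiv.mk' (Equiv.arrowProdEquivProdArrow (Fin N) (fun _ => P) fun _ => G') fun _ _ => rfl)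
  let e₃ : ((Fin N → K) × (Fin N → K) × (Fin N → K)) ≃+ (Q × G₁) × ((Q × G₁) × (Q × G₁)) :=
    AddEquiv.prodCongr e₁ (AddEquiv.prodCongr e₁ e₁)
  let e₄ : (Q × G₁) × ((Q × G₁) × (Q × G₁)) ≃+ (Q × G₁) × ((Q × Q) × (G₁ × G₁)) :=
    AddEquiv.prodCongr (AddEquiv.refl _) (AddEquiv.prodProdProdComm Q G₁ Q G₁)
  let e₅ : (Q × G₁) × ((Q × Q) × (G₁ × G₁)) ≃+ (Q × (Q × Q)) × (G₁ × (G₁ × G₁)) :=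
    AddEquiv.prodProdProdComm Q G₁ (Q × Q) (G₁ × G₁)
  let u₂ : (Q × Q) ≃+ (Fin N ⊕ Fin N → P) :=
    (AddEquiv.mk' (Equiv.sumArrowEquivProdArrow (Fin N) (Fin N) P) fun _ _ => rfl).symm
  let u₃ : (Q × (Fin N ⊕ Fin N → P)) ≃+ (Fin N ⊕ (Fin N ⊕ Fin N) → P) :=
    (AddEquiv.mk' (Equiv.sumArrowEquivProdArrow (Fin N) (Fin N ⊕ Fin N) P) fun _ _ => rfl).symm
  let e₆ : ((Fin N → K) × (Fin N → K) × (Fin N → K)) ≃+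
      (Fin N ⊕ (Fin N ⊕ Fin N) → P) × (G₁ × (G₁ × G₁)) :=
    (e₃.trans (e₄.trans e₅)).trans
      (AddEquiv.prodCongr ((AddEquiv.prodCongr (AddEquiv.refl Q) u₂).trans u₃) (AddEquiv.refl _))
  exact ⟨(AddEquiv.piCongrRight fun _ : Fin N' => e₆).trans
    (AddEquiv.mk' (Equiv.arrowProdEquivProdArrow (Fin N') (fun _ => Fin N ⊕ (Fin N ⊕ Fin N) → P)
      fun _ => G₁ × (G₁ × G₁)) fun _ _ => rfl)⟩

/-! ## §3 The registered stub: the rank-form slice-rank packing bound -/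

/-- **Rank-form slice-rank packing bound** (registered stub `stub_rankPackingBound` of the U2
universality glue `HomocyclicSTPPDesigns_of_subs`; BCCGNSU 2017, Thm. 4.14 + §3.2 with
per-coordinate moduli): for ONE prime `p`, exponents `r_l ≥ 1` and any finite abelian `G'`, every
STPP family in `K ≃ (Π_{l<n} ℤ/p^{r_l}) × G'` has `Σ_i (|A_i||B_i||C_i|)^{2/3} ≤ ((3/4)·2^{1/3})^n · |K|`
(`= e^{-δn}|K|`): the §3.2 engine `sum_rpow_two_thirds_le_of_tsf` with `|K|^{1-δ'} := ((3/4)2^{1/3})^n|K|`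
(`n = 0`, `δ' = 0` if `|K| = 1`), fed with `card_le_of_addEquiv_arrow₂` in the powers `((K^N)^3)^{N'}`.
[cite: BlasiakChurchCohnGrochowNaslundSawinUmans2017, Thm. 4.14 and §3.2] -/
theorem stub_rankPackingBound : ∀ (p : ℕ) [Fact p.Prime] (n : ℕ) (r : Fin n → ℕ), (∀ l, 1 ≤ r l) →
    ∀ (G' : Type) [AddCommGroup G'] [Fintype G'] [DecidableEq G'] (K : Type) [AddCommGroup K]
    [Fintype K] [DecidableEq K], Nonempty (K ≃+ ((l : Fin n) → ZMod (p ^ r l)) × G') →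
    ∀ (N : ℕ) (A B C : Fin N → Finset K), Literature.Computability.AlgebraicComplexity.IsSTPP A B C →
    ∑ i, (((A i).card * (B i).card * (C i).card : ℕ) : ℝ) ^ ((2 : ℝ) / 3) ≤
    ((3 : ℝ) / 4 * (2 : ℝ) ^ ((1 : ℝ) / 3)) ^ n * (Fintype.card K : ℝ) := by
  intro p _ n r hr G' _ _ _ K _ _ _ hK N A B C hS
  obtain ⟨e⟩ := hK
  have hS' := (isSTPP_iff_addSimultaneousTPP A B C).1 hS
  set c : ℝ := (3 : ℝ) / 4 * (2 : ℝ) ^ ((1 : ℝ) / 3) with hc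
  have hKpos : (0 : ℝ) < Fintype.card K := by exact_mod_cast Fintype.card_pos
  set Y : ℝ := c ^ n * Fintype.card K with hY
  have hYpos : 0 < Y := by positivity
  -- `|K|^{1-δ} = Y` for a suitable `δ`
  obtain ⟨δ, hKδ⟩ : ∃ δ : ℝ, (Fintype.card K : ℝ) ^ (1 - δ) = Y := by
    by_cases hK1 : 1 < Fintype.card K
    · have hK1' : (1 : ℝ) < Fintype.card K := by exact_mod_cast hK1
      refine ⟨1 - Real.log Y / Real.log (Fintype.card K), ?_⟩
      rw [sub_sub_cancel, Real.rpow_def_of_pos hKpos, mul_div_cancel₀ _ (Real.log_pos hK1').ne',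
        Real.exp_log hYpos]
    · -- `|K| = 1`, hence `n = 0` and `Y = 1`
      have hK1 : Fintype.card K = 1 := le_antisymm (not_lt.1 hK1) Fintype.card_pos
      have hn : n = 0 := by
        by_contra hn
        have hcard := Fintype.card_congr e.toEquiv
        rw [hK1, Fintype.card_prod, Fintype.card_pi] at hcard
        have h2 : 2 ^ n ≤ ∏ l : Fin n, Fintype.card (ZMod (p ^ r l)) := by
          have h := Finset.prod_le_prod (s := (univ : Finset (Fin n))) (fun l _ => Nat.zero_le 2)
            fun l _ => (ZMod.card (p ^ r l)).symm ▸ le_trans (Fact.out : p.Prime).two_le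
              (Nat.le_self_pow (by have := hr l; omega) p)
          simpa using h
        have h3 : 2 * 1 ≤ (∏ l : Fin n, Fintype.card (ZMod (p ^ r l))) * Fintype.card G' :=
          Nat.mul_le_mul (le_trans (Nat.one_lt_two_pow_iff.mpr hn) h2) Fintype.card_pos
        omega
      subst hn
      refine ⟨0, ?_⟩
      rw [hY, hK1, pow_zero]
      norm_num
  -- the tricolored-sum-free bound in all the powers `((K^N₁)^3)^N'`, then the §3.2 engine
  have hT : ∀ (N₁ N' : ℕ) (ι' : Type) [Fintype ι']
      (s t u : ι' → (Fin N' → (Fin N₁ → K) × (Fin N₁ → K) × (Fin N₁ → K))),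
      IsTricoloredSumFree s t u →
        (Fintype.card ι' : ℝ) ≤ 3 * (((Fintype.card K : ℝ) ^ (1 - δ)) ^ (3 * N₁)) ^ N' := by
    intro N₁ N' ι' _ s t u hTSF
    obtain ⟨e₃⟩ := nonempty_addEquiv_pow e N₁ N'
    refine (card_le_of_addEquiv_arrow₂ (p := p) r hr (Fin N') (Fin N₁ ⊕ (Fin N₁ ⊕ Fin N₁))
      e₃ hTSF).trans (le_of_eq ?_)
    simp only [hKδ, hY, Fintype.card_sum, Fintype.card_fin, Fintype.card_fun, Fintype.card_prod,
      Nat.cast_pow, Nat.cast_mul]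
    ring
  have h := sum_rpow_two_thirds_le_of_tsf hT hS'
  rwa [hKδ] at h

end Summit.MatrixMultiplication.MatrixMultiplication.Theorems.HomocyclicSTPPDesigns.Universality
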